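import Summits.ResolutionOfSingularities.KangarooAtlas.MizutaniOneForm
import Summits.ResolutionOfSingularities.KangarooAtlas.MizutaniExpandShift
import HarnessLib

/-!
# Reduction to ONE top invariant form in a SMALLER projective space (Mizutani 1973, Lemma 2.6: «dim H₁ = d»)

Cell `pub-rosobs`, Mizutani enclosure (seat mizutani-encloser-2, gen 9). AI-written; *AI review is weaker than expert
review*; NOT a resolution-of-singularities theorem (summit relevance C).

Sequel to `MizutaniOneForm.lean`.  There, for a point `𝔭` of `ℙ^n_k` with `exponent B(𝔭) = e + 1`, a minimal-support top
invariant form `f ∈ (L_B)_{e+1}(𝔭)` spans a `𝒥𝒟`-closed line not defined over `k^p`, hence is the single top form of a point of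
`ℙ^n_k` of the same exponent — Mizutani's `H₁` times a vector group.  Mizutani's `H₁ = H(k·f₁, k^q Y₁ ⊕ Σ k^q X_a)` lives in the
SMALLER ambient vector group spanned by the coordinates that `f₁` uses; this file performs that reduction for points: restrict
`f` to its support `T` (`|T| = m + 1`, the embedding `ι : Fin (m+1) ↪ Fin (n+1)`, extension by zero = `vecMul` by the `0/1`-matrix of `ι`):

* `vecMul_indicator_apply_eq` / `_of_forall_ne`, `vecMul_indicator_comp`, `vecMul_indicator_comp_of_support`,
  `apply_vecMul_indicator`, `frobVec_vecMul_indicator` — bookkeeping of the extension-by-zero map;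
* **`jCore_dSpan_span_singleton_comp`** — the closedness `𝒥_e𝒟_e(k·f) = k·f` descends to `k·(f ∘ ι) ⊆ k^{m+1}`;
  **`span_singleton_comp_ne_span_inter_range`** — so does «not defined over `k^p`»; `span_singleton_ne_top_of_ne_span_inter_range`;
* `card_support_le_hsDim_succ` — a minimal-support `f ∈ (L_B)_{e+1}(𝔭)` has `|supp f| ≤ dim B(𝔭) + 1` (the coordinates off the
  support separate `(L_B)_{e+1}(𝔭)/k·f`);
* **`exists_point_one_form_ambient`** — LEMMA 2.6 «MOREOVER» WITH THE AMBIENT REDUCTION: for a point `𝔭` of `ℙ^n_k` with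
  `exponent B(𝔭) = e + 1` there are `m ≤ dim B(𝔭)` and a point `𝔭₁` of `ℙ^m_k` with `exponent B(𝔭₁) = e + 1`, ONE top invariant form
  and `dim B(𝔭₁) = m` (`m + 1` = the number of coordinates used by the form; Mizutani's `H₁` with `W₁` minimal has `dim H₁ = d`
  exactly — here `m ≤ d`, the minimal-support form possibly using fewer coordinates than an echelon vector).

## References

* H. Mizutani, *Hironaka's additive group schemes*, Nagoya Math. J. 52 (1973) 85–95, Lemma 2.6 (p. 89). [Mizutani1973HironakaGroupSchemes]
* T. Oda, *Hironaka's additive group scheme, II*, Publ. RIMS 19 (1983), Thm. 3.1. [Oda1983HironakaGroupSchemeII]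
-/

noncomputable section

open MvPolynomial Literature.AlgebraicGeometry.Resolution Literature.AlgebraicGeometry.Resolution.HironakaScheme
  Literature.RingTheory.MvPolynomial

namespace Summit.ResolutionOfSingularities.KangarooAtlas.Mizutani

universe u

/-! ## Extension by zero along an injection of coordinates -/

section Embed

variable (k : Type u) [Field k] (p : ℕ) [hp : Fact p.Prime] [CharP k p] {n m : ℕ} {ι : Fin (m + 1) → Fin (n + 1)}

omit hp [CharP k p] in
/-- Extension by zero, on the image of `ι`: `(a ᵥ* P_ι) (ι j) = a j`. [folklore] -/
theorem vecMul_indicator_apply_eq (hι : Function.Injective ι) (a : Fin (m + 1) → k) (j : Fin (m + 1)) :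
    Matrix.vecMul a (Matrix.of fun (j : Fin (m + 1)) (i : Fin (n + 1)) => if ι j = i then (1 : k) else 0) (ι j) = a j := by
  classical
  rw [Matrix.vecMul, dotProduct]
  simp only [Matrix.of_apply, hι.eq_iff, mul_ite, mul_one, mul_zero]
  rw [Finset.sum_ite_eq' Finset.univ j]
  simp

omit hp [CharP k p] in
/-- Extension by zero, off the image of `ι`: `(a ᵥ* P_ι) i = 0`. [folklore] -/
theorem vecMul_indicator_apply_of_forall_ne (a : Fin (m + 1) → k) {i : Fin (n + 1)} (hi : ∀ j, ι j ≠ i) :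
    Matrix.vecMul a (Matrix.of fun (j : Fin (m + 1)) (i : Fin (n + 1)) => if ι j = i then (1 : k) else 0) i = 0 := by
  rw [Matrix.vecMul, dotProduct]
  exact Finset.sum_eq_zero fun j _ => by rw [Matrix.of_apply, if_neg (hi j), mul_zero]

omit hp [CharP k p] in
/-- Restriction after extension is the identity: `(a ᵥ* P_ι) ∘ ι = a`. [folklore] -/
theorem vecMul_indicator_comp (hι : Function.Injective ι) (a : Fin (m + 1) → k) :
    (Matrix.vecMul a (Matrix.of fun (j : Fin (m + 1)) (i : Fin (n + 1)) => if ι j = i then (1 : k) else 0)) ∘ ι = a :=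
  funext fun j => vecMul_indicator_apply_eq k hι a j

omit hp [CharP k p] in
/-- Extension after restriction is the identity on vectors supported in the image of `ι`. [folklore] -/
theorem vecMul_indicator_comp_of_support (hι : Function.Injective ι) {w : Fin (n + 1) → k}
    (hw : ∀ i, (∀ j, ι j ≠ i) → w i = 0) :
    Matrix.vecMul (w ∘ ι) (Matrix.of fun (j : Fin (m + 1)) (i : Fin (n + 1)) => if ι j = i then (1 : k) else 0) = w := by
  funext i
  by_cases h : ∃ j, ι j = i
  · obtain ⟨j, rfl⟩ := h
    rw [vecMul_indicator_apply_eq k hι]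
    rfl
  · push Not at h
    rw [vecMul_indicator_apply_of_forall_ne k _ h, hw i h]

omit hp [CharP k p] in
/-- An additive map commutes with extension by zero: `D((a ᵥ* P_ι)_i) = ((D ∘ a) ᵥ* P_ι)_i`. [folklore] -/
theorem apply_vecMul_indicator (hι : Function.Injective ι) {R : Type*} [Semiring R] [Module R k] (D : k →ₗ[R] k)
    (a : Fin (m + 1) → k) :
    (fun i => D (Matrix.vecMul a (Matrix.of fun (j : Fin (m + 1)) (i : Fin (n + 1)) => if ι j = i then (1 : k) else 0) i)) =
      Matrix.vecMul (fun j => D (a j))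
        (Matrix.of fun (j : Fin (m + 1)) (i : Fin (n + 1)) => if ι j = i then (1 : k) else 0) := by
  funext i
  by_cases h : ∃ j, ι j = i
  · obtain ⟨j, rfl⟩ := h
    rw [vecMul_indicator_apply_eq k hι, vecMul_indicator_apply_eq k hι]
  · push Not at h
    rw [vecMul_indicator_apply_of_forall_ne k _ h, vecMul_indicator_apply_of_forall_ne k _ h, map_zero]

omit [CharP k p] in
/-- `F` commutes with extension by zero. [folklore] -/
theorem frobVec_vecMul_indicator (hι : Function.Injective ι) (e : ℕ) (b : Fin (m + 1) → k) :
    frobVec k p e (Matrix.vecMul b (Matrix.of fun (j : Fin (m + 1)) (i : Fin (n + 1)) => if ι j = i then (1 : k) else 0)) =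
      Matrix.vecMul (frobVec k p e b)
        (Matrix.of fun (j : Fin (m + 1)) (i : Fin (n + 1)) => if ι j = i then (1 : k) else 0) := by
  funext i
  unfold frobVec
  by_cases h : ∃ j, ι j = i
  · obtain ⟨j, rfl⟩ := h
    rw [vecMul_indicator_apply_eq k hι, vecMul_indicator_apply_eq k hι]
  · push Not at h
    rw [vecMul_indicator_apply_of_forall_ne k _ h, vecMul_indicator_apply_of_forall_ne k _ h,
      zero_pow (pow_ne_zero _ hp.out.ne_zero)]

variable (e : ℕ)

/-- Extension by zero maps `𝒟_e(k·(f ∘ ι))` into `𝒟_e(k·f)` (for `f` supported in the image of `ι`). [cite: Mizutani1973HironakaGroupSchemes, §1 (b)] -/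
theorem dSpan_span_singleton_comp_le_comap (hι : Function.Injective ι) {f : Fin (n + 1) → k}
    (hf : ∀ i, (∀ j, ι j ≠ i) → f i = 0) :
    dSpan k p e (k ∙ (f ∘ ι)) ≤ (dSpan k p e (k ∙ f)).comap
      (Matrix.vecMulLinear (Matrix.of fun (j : Fin (m + 1)) (i : Fin (n + 1)) => if ι j = i then (1 : k) else 0)) := by
  unfold dSpan
  rw [Submodule.span_le]
  rintro _ ⟨v, hv, D, hD, rfl⟩
  obtain ⟨c, rfl⟩ := Submodule.mem_span_singleton.mp hv
  rw [SetLike.mem_coe, Submodule.mem_comap, Matrix.vecMulLinear_apply, ← apply_vecMul_indicator k hι,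
    show c • (f ∘ ι) = (c • f) ∘ ι from rfl, vecMul_indicator_comp_of_support k hι
      (fun i hi => by rw [Pi.smul_apply, hf i hi, smul_zero])]
  exact Submodule.subset_span ⟨c • f, Submodule.mem_span_singleton.mpr ⟨c, rfl⟩, D, hD, rfl⟩

/-- **The closedness descends to the support**: if `f ∈ k^{n+1}` is supported in the image of `ι` and `𝒥_e𝒟_e(k·f) = k·f`, then
`𝒥_e𝒟_e(k·(f ∘ ι)) = k·(f ∘ ι)` in `k^{m+1}`. [cite: Mizutani1973HironakaGroupSchemes, Lemma 2.6] -/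
theorem jCore_dSpan_span_singleton_comp (hι : Function.Injective ι) {f : Fin (n + 1) → k}
    (hf : ∀ i, (∀ j, ι j ≠ i) → f i = 0) (hcl : jCore k p e (dSpan k p e (k ∙ f)) = k ∙ f) :
    jCore k p e (dSpan k p e (k ∙ (f ∘ ι))) = k ∙ (f ∘ ι) := by
  refine le_antisymm ?_ (le_jCore_dSpan k p e _)
  intro a ha
  set P : Matrix (Fin (m + 1)) (Fin (n + 1)) k := Matrix.of fun j i => if ι j = i then (1 : k) else 0 with hP
  -- the extension `a ᵥ* P` lies in `𝒥_e𝒟_e(k·f) = k·f`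
  have ha' : Matrix.vecMul a P ∈ jCore k p e (dSpan k p e (k ∙ f)) := by
    rw [mem_jCore_iff]
    intro D hD
    rw [apply_vecMul_indicator k hι]
    exact dSpan_span_singleton_comp_le_comap k p e hι hf ((mem_jCore_iff k p).mp ha D hD)
  rw [hcl] at ha'
  obtain ⟨c, hc⟩ := Submodule.mem_span_singleton.mp ha'
  rw [Submodule.mem_span_singleton]
  refine ⟨c, ?_⟩
  rw [← vecMul_indicator_comp k hι a, ← hP, ← hc]
  rfl

omit [CharP k p] in
/-- **«Not defined over `k^p`» descends to the support.** [cite: Mizutani1973HironakaGroupSchemes, (*) (iii)] -/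
theorem span_singleton_comp_ne_span_inter_range (hι : Function.Injective ι) {f : Fin (n + 1) → k}
    (hf : ∀ i, (∀ j, ι j ≠ i) → f i = 0)
    (hfp : (k ∙ f : Submodule k (Fin (n + 1) → k)) ≠
      Submodule.span k (((k ∙ f : Submodule k (Fin (n + 1) → k)) : Set (Fin (n + 1) → k)) ∩ Set.range (frobVec k p 1))) :
    (k ∙ (f ∘ ι) : Submodule k (Fin (m + 1) → k)) ≠
      Submodule.span k (((k ∙ (f ∘ ι) : Submodule k (Fin (m + 1) → k)) : Set (Fin (m + 1) → k)) ∩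
        Set.range (frobVec k p 1)) := by
  intro h
  apply hfp
  refine le_antisymm ?_ (Submodule.span_le.mpr fun w hw => hw.1)
  rw [Submodule.span_singleton_le_iff_mem]
  set P : Matrix (Fin (m + 1)) (Fin (n + 1)) k := Matrix.of fun j i => if ι j = i then (1 : k) else 0 with hP
  have hg : f ∘ ι ∈ Submodule.span k (((k ∙ (f ∘ ι) : Submodule k (Fin (m + 1) → k)) : Set (Fin (m + 1) → k)) ∩
      Set.range (frobVec k p 1)) := by
    rw [← h]; exact Submodule.mem_span_singleton_self _
  have hmap := Submodule.mem_map_of_mem (f := Matrix.vecMulLinear P) hg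
  rw [Matrix.vecMulLinear_apply, vecMul_indicator_comp_of_support k hι hf, Submodule.map_span] at hmap
  refine Submodule.span_mono ?_ hmap
  rintro _ ⟨w, ⟨hw, b, rfl⟩, rfl⟩
  obtain ⟨c, hc⟩ := Submodule.mem_span_singleton.mp hw
  refine ⟨?_, Matrix.vecMul b P, ?_⟩
  · rw [SetLike.mem_coe, Matrix.vecMulLinear_apply, ← hc, Matrix.smul_vecMul, vecMul_indicator_comp_of_support k hι hf]
    exact Submodule.smul_mem _ c (Submodule.mem_span_singleton_self f)
  · rw [Matrix.vecMulLinear_apply, hP, frobVec_vecMul_indicator k p hι]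

omit [CharP k p] in
/-- A line not spanned by its `k^p`-vectors is a proper subspace (the unit vectors are `k^p`-vectors spanning everything). [folklore] -/
theorem span_singleton_ne_top_of_ne_span_inter_range {N : ℕ} {g : Fin (N + 1) → k}
    (hgp : (k ∙ g : Submodule k (Fin (N + 1) → k)) ≠
      Submodule.span k (((k ∙ g : Submodule k (Fin (N + 1) → k)) : Set (Fin (N + 1) → k)) ∩ Set.range (frobVec k p 1))) :
    (k ∙ g : Submodule k (Fin (N + 1) → k)) ≠ ⊤ := by
  intro htop
  apply hgp
  refine le_antisymm ?_ (Submodule.span_le.mpr fun w hw => hw.1)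
  rw [htop]
  -- every unit vector is a `p`-th power vector in `⊤`
  have h1 : (⊤ : Submodule k (Fin (N + 1) → k)) = Submodule.span k (Set.range (Pi.basisFun k (Fin (N + 1)))) :=
    (Pi.basisFun k (Fin (N + 1))).span_eq.symm
  conv_lhs => rw [h1]
  refine Submodule.span_le.mpr ?_
  rintro _ ⟨i, rfl⟩
  refine Submodule.subset_span ⟨Submodule.mem_top, Pi.single i 1, ?_⟩
  rw [Pi.basisFun_apply, frobVec_single]

end Embed

/-! ## The support of a minimal-support top form has at most `dim B + 1` elements -/

section Count

variable (k : Type u) [Field k] (p : ℕ) [hp : Fact p.Prime] [CharP k p] {n : ℕ}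
  (𝔭 : Ideal (MvPolynomial (Fin (n + 1)) k)) (e : ℕ)

open Classical in
omit hp [CharP k p] in
/-- **A circuit of `V` uses at most `n + 2 − dim V` coordinates**: the coordinates off `supp f` separate `V / k·f`. [folklore] -/
theorem card_support_add_finrank_le (V : Submodule k (Fin (n + 1) → k)) {f : Fin (n + 1) → k} (hfV : f ∈ V) (hf0 : f ≠ 0)
    (hmin : ∀ g ∈ V, g ≠ 0 → (∀ i, f i = 0 → g i = 0) → ∀ i, g i = 0 → f i = 0) :
    (Finset.univ.filter fun i => f i ≠ 0).card + Module.finrank k V ≤ n + 2 := by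
  classical
  set T := Finset.univ.filter fun i => f i ≠ 0 with hT
  -- restriction of `V` to the coordinates OFF the support
  set ρ : V →ₗ[k] ({i : Fin (n + 1) // i ∉ T} → k) :=
    (LinearMap.funLeft k k (Subtype.val : {i : Fin (n + 1) // i ∉ T} → Fin (n + 1))).comp V.subtype with hρ
  have hrn := LinearMap.finrank_range_add_finrank_ker ρ
  -- the kernel is inside `k·f`
  have hker : (LinearMap.ker ρ).map V.subtype ≤ k ∙ f := by
    rintro _ ⟨w, hw, rfl⟩
    have hw : ρ w = 0 := hw
    refine mem_span_singleton_of_minSupp k V hfV hf0 hmin w.2 fun i hi => ?_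
    have hiT : i ∉ T := by rw [hT, Finset.mem_filter]; exact fun h => h.2 hi
    have := congrFun hw ⟨i, hiT⟩
    exact this
  have hker1 : Module.finrank k (LinearMap.ker ρ) ≤ 1 := by
    rw [← Submodule.finrank_map_subtype_eq V (LinearMap.ker ρ)]
    exact (Submodule.finrank_mono hker).trans (finrank_span_singleton hf0).le
  have hrange : Module.finrank k (LinearMap.range ρ) ≤ n + 1 - T.card := by
    have h := Submodule.finrank_le (LinearMap.range ρ)
    have hc : Module.finrank k ({i : Fin (n + 1) // i ∉ T} → k) = n + 1 - T.card := by
      rw [Module.finrank_fintype_fun_eq_card, Fintype.card_subtype_compl, Fintype.card_fin, Fintype.card_coe]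
    rwa [hc] at h
  have hTle : T.card ≤ n + 1 := (Finset.card_le_univ T).trans (by rw [Fintype.card_fin])
  omega

open Classical in
/-- Hence for a minimal-support TOP invariant form of a point: `|supp f| ≤ dim B(𝔭) + 1`.
[cite: Mizutani1973HironakaGroupSchemes, Lemma 2.6 (dim H₁ = d) and Thm. 1.3 (dim B = dim_k L_e/N_e)] -/
theorem card_support_le_hsDim_succ [𝔭.IsPrime] (hE : ExponentLE k p 𝔭 e) {f : Fin (n + 1) → k}
    (hfV : f ∈ invForms k p 𝔭 e) (hf0 : f ≠ 0)
    (hmin : ∀ g ∈ invForms k p 𝔭 e, g ≠ 0 → (∀ i, f i = 0 → g i = 0) → ∀ i, g i = 0 → f i = 0) :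
    (Finset.univ.filter fun i => f i ≠ 0).card ≤ hsDim k p 𝔭 + 1 := by
  have h := card_support_add_finrank_le k (invForms k p 𝔭 e) hfV hf0 hmin
  rw [← hsDimAt_eq_hsDim k p 𝔭 hE]
  unfold hsDimAt
  have := finrank_invForms_le k p 𝔭 e
  omega

end Count

/-! ## Lemma 2.6 «moreover», with the ambient reduction -/

section Main

variable (k : Type u) [Field k] (p : ℕ) [hp : Fact p.Prime] [CharP k p] {n : ℕ}
  (𝔭 : Ideal (MvPolynomial (Fin (n + 1)) k)) (e : ℕ)

/-- **LEMMA 2.6 «MOREOVER» WITH THE SMALLER AMBIENT SPACE.**  For a point `𝔭` of `ℙ^n_k` with `exponent B(𝔭) = e + 1` there are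
`m ≤ dim B(𝔭)` and a point `𝔭₁` of `ℙ^m_k` with `exponent B(𝔭₁) = e + 1`, exactly ONE top invariant form
(`dim_k (L_B)_{e+1}(𝔭₁) = 1`) and `dim B(𝔭₁) = m`: restrict a minimal-support top form of `𝔭` not defined over `k^p`
(`MizutaniOneForm`) to its support (`m + 1 = |supp f|`) and realise the closed line `k·(f|_{supp f})` by Thm. 1.3.
[cite: Mizutani1973HironakaGroupSchemes, Lemma 2.6 ("Moreover we can choose f_1 so that H_1 … dim H_1 = d and e(H_1) = e")] -/
theorem exists_point_one_form_ambient [𝔭.IsPrime] (hP : IsPoint k 𝔭) (he : exponent k p 𝔭 = e + 1) :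
    ∃ m : ℕ, m ≤ hsDim k p 𝔭 ∧
      ∃ 𝔭₁ : Ideal (MvPolynomial (Fin (m + 1)) k), IsPoint k 𝔭₁ ∧ exponent k p 𝔭₁ = e + 1 ∧
        Module.finrank k (invForms k p 𝔭₁ (e + 1)) = 1 ∧ hsDim k p 𝔭₁ = m := by
  classical
  set V := invForms k p 𝔭 (e + 1) with hVdef
  have hE : ExponentLE k p 𝔭 (e + 1) := (exponent_le_iff k p 𝔭).mp he.le
  obtain ⟨hne, hcl, hiii⟩ := (exists_isPoint_exponent_eq_succ_iff k p e V).mp ⟨𝔭, hP, he, rfl⟩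
  -- a minimal-support top form spanning a line not defined over `k^p` (as in `MizutaniOneForm`)
  have hex : ∃ f, f ∈ V ∧ f ≠ 0 ∧ (∀ g ∈ V, g ≠ 0 → (∀ i, f i = 0 → g i = 0) → ∀ i, g i = 0 → f i = 0) ∧
      (k ∙ f) ≠ Submodule.span k (((k ∙ f : Submodule k (Fin (n + 1) → k)) : Set (Fin (n + 1) → k)) ∩
        Set.range (frobVec k p 1)) := by
    by_contra hall
    push Not at hall
    apply hiii
    refine le_antisymm ?_ (Submodule.span_le.mpr fun g hg => hg.1)
    conv_lhs => rw [← span_minSupp_eq k V]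
    rw [Submodule.span_le]
    rintro f ⟨hfV, hf0, hmin⟩
    have hline := hall f hfV hf0 hmin
    have hf : f ∈ (k ∙ f : Submodule k (Fin (n + 1) → k)) := Submodule.mem_span_singleton_self f
    rw [hline] at hf
    refine Submodule.span_mono ?_ hf
    exact Set.inter_subset_inter_left _ fun g hg =>
      (Submodule.span_singleton_le_iff_mem f V).mpr hfV hg
  obtain ⟨f, hfV, hf0, hmin, hfp⟩ := hex
  have hclf : jCore k p (e + 1) (dSpan k p (e + 1) (k ∙ f)) = k ∙ f :=
    jCore_dSpan_span_singleton_of_minSupp k p (e + 1) hcl hfV hf0 hmin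
  -- the support and its enumeration
  set T := Finset.univ.filter fun i => f i ≠ 0 with hT
  have hTpos : 0 < T.card := by
    rw [Finset.card_pos]
    by_contra hem
    rw [Finset.not_nonempty_iff_eq_empty] at hem
    apply hf0
    funext i
    by_contra hi
    have : i ∈ T := Finset.mem_filter.mpr ⟨Finset.mem_univ i, hi⟩
    rw [hem] at this
    exact Finset.notMem_empty i this
  obtain ⟨m, hm⟩ : ∃ m, T.card = m + 1 := ⟨T.card - 1, by omega⟩
  set ι : Fin (m + 1) → Fin (n + 1) := fun j => T.orderEmbOfFin hm j with hιdef
  have hι : Function.Injective ι := fun a b h => (T.orderEmbOfFin hm).injective h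
  have hrange : ∀ i, i ∈ T ↔ ∃ j, ι j = i := by
    intro i
    have h := Finset.range_orderEmbOfFin T hm
    constructor
    · intro hi
      have : i ∈ Set.range (T.orderEmbOfFin hm) := by rw [h]; exact hi
      obtain ⟨j, hj⟩ := this
      exact ⟨j, hj⟩
    · rintro ⟨j, rfl⟩
      have : ι j ∈ Set.range (T.orderEmbOfFin hm) := ⟨j, rfl⟩
      rw [h] at this
      exact this
  have hfsupp : ∀ i, (∀ j, ι j ≠ i) → f i = 0 := by
    intro i hi
    by_contra hfi
    obtain ⟨j, hj⟩ := (hrange i).mp (Finset.mem_filter.mpr ⟨Finset.mem_univ i, hfi⟩)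
    exact hi j hj
  -- the restricted line is closed, proper and not defined over `k^p`
  have hcl₁ := jCore_dSpan_span_singleton_comp k p (e + 1) hι hfsupp hclf
  have hfp₁ := span_singleton_comp_ne_span_inter_range k p hι hfsupp hfp
  have hne₁ := span_singleton_ne_top_of_ne_span_inter_range k p hfp₁
  obtain ⟨𝔭₁, hP₁, he₁, hinv₁⟩ := (exists_isPoint_exponent_eq_succ_iff k p e (k ∙ (f ∘ ι))).mpr ⟨hne₁, hcl₁, hfp₁⟩
  haveI := hP₁.1
  have hg0 : f ∘ ι ≠ 0 := by
    intro h0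
    apply hf0
    rw [← vecMul_indicator_comp_of_support k hι hfsupp, h0, Matrix.zero_vecMul]
  have hfin : Module.finrank k (invForms k p 𝔭₁ (e + 1)) = 1 := by
    rw [hinv₁]; exact finrank_span_singleton hg0
  refine ⟨m, ?_, 𝔭₁, hP₁, he₁, hfin, ?_⟩
  · have hcard := card_support_le_hsDim_succ k p 𝔭 (e + 1) hE hfV hf0 hmin
    rw [← hT, hm] at hcard
    omega
  · have hE₁ : ExponentLE k p 𝔭₁ (e + 1) := (exponent_le_iff k p 𝔭₁).mp he₁.le
    rw [← hsDimAt_eq_hsDim k p 𝔭₁ hE₁]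
    unfold hsDimAt
    rw [hfin]
    omega

end Main

end Summit.ResolutionOfSingularities.KangarooAtlas.Mizutani

end
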